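import Summits.CriticalPhenomena.PercolationContinuityZ3.Theorems.PercNearOneGluingNoHeavyLowerTailSahiCTCLadderSqfreeT
import Summits.CriticalPhenomena.PercolationContinuityZ3.Theorems.PercNearOneGluingNoHeavyLowerTailSahiCTCVertexAtoms
import HarnessLib

/-!
# `NoHeavyLowerTail` (crux stmt-CriticalPhenomena-4575), P3 lane: the IDLE CORNER of the one-vertex inequality C2 at levels (1,2),
# coefficientwise, for ALL pairs of proper up-sets — `(1 + Θ₁)·H − Π·GF(common singletons) ∈ ℕ[s]`

Support file (seat `prim-l12-p3`, gen 41; `--supports stmt-CriticalPhenomena-4575`).  Memo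
`run/shared/lean/prim/prim-l12/FROM-prim-l12-p3-g41-RUSSO-MONOTONE.md` §4.4.  With `H := Π·GF(𝒳∩𝒵) − GF(𝒳)·GF(𝒵)` (the Harris form, `∈ ℕ[s]` by
`…SahiCTCHarrisUp`) and `Θ₁ = Th1 = GF(sets of size ≤ 1)`, the polynomial `W₁ := (1 + Θ₁)·H − Π·GF({i} ∈ 𝒳 ∩ 𝒵)` has nonnegative coefficients
for all up-sets `𝒳, 𝒵` not containing `∅` (`coeff_idleTwoLevelOne_nonneg`).  By the identity `Qc₁ = Θ₁·W₁` of the memo (§4.4) this is the coefficientwise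
form of the two-level inequality `Q_1` of memo g29 (2.3) — the "idle corner" of the value-level one-vertex inequality C2 at levels (1,2) — for EVERY pair; at a
positive point it reads `(2 + Σ_i r_i)·Cov_μ(𝒳,𝒵) ≥ μ(∅)·Σ_{ {i} ∈ 𝒳∩𝒵 } r_i`.  PROOF: `[s^m]W₁ = 2κ(m) + Σ_i κ(m − e_i) − #{common singletons {i} with
m − e_i squarefree}` (κ = Kleitman surplus = coefficient of `H`, `…SahiCTCLadderPrep.coeff_harrisForm_eq_kap`), and a common singleton inside a set `M`
forces `κ(∅, M) ≥ 1` (`…SahiCTCKleitmanSurplus.one_le_kap_of_loop`): either every subtracted unit is paid by the shifted term at the same index, or the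
profile is squarefree with exactly one common singleton and `2κ(m) ≥ 2` pays.  Nothing is asserted about the crux.
-/

namespace Summit.CriticalPhenomena.PercolationContinuityZ3.Theorems.SahiCTCForms

open Finset MvPolynomial SahiCTCGenFun

variable {α : Type*} [DecidableEq α] [Fintype α]

/-- The coefficient of `Π = GF(2^α)` at `n` is at most `1` (the exponent vectors `1_S` are distinct). [this work] -/
theorem coeff_PiP_le_one (n : α →₀ ℕ) : (PiP : MvPolynomial α ℤ).coeff n ≤ 1 := by
  unfold PiP
  rw [coeff_gf]
  have h : #((univ.powerset : Finset (Finset α)).filter fun S => ind S = n) ≤ 1 :=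
    card_le_one.2 fun S hS S' hS' => ind_injective (((mem_filter.1 hS).2).trans ((mem_filter.1 hS').2).symm)
  exact_mod_cast h

/-- If the coefficient of `Π` at `n` is positive then `n = 1_S` for some finset `S`. [this work] -/
theorem exists_ind_eq_of_coeff_PiP_pos {n : α →₀ ℕ} (h : 0 < (PiP : MvPolynomial α ℤ).coeff n) : ∃ S : Finset α, ind S = n := by
  unfold PiP at h
  rw [coeff_gf] at h
  have h' : 0 < #((univ.powerset : Finset (Finset α)).filter fun S => ind S = n) := by exact_mod_cast h
  obtain ⟨S, hS⟩ := card_pos.1 h'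
  exact ⟨S, (mem_filter.1 hS).2⟩

/-- **THE IDLE CORNER OF C2 AT LEVELS (1,2), ALL PAIRS** (memo g41 §4.4): for up-sets `𝒳, 𝒵` with `∅ ∉ 𝒳`, `∅ ∉ 𝒵`, every coefficient of
`(1 + Θ₁)·(Π·GF(𝒳∩𝒵) − GF(𝒳)GF(𝒵)) − Π·GF({S ∈ 𝒳∩𝒵 : #S = 1})` is `≥ 0`. [this work] -/
theorem coeff_idleTwoLevelOne_nonneg {𝒳 𝒵 : Finset (Finset α)} (h𝒳 : IsUpperSet (𝒳 : Set (Finset α)))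
    (h𝒵 : IsUpperSet (𝒵 : Set (Finset α))) (h𝒳e : (∅ : Finset α) ∉ 𝒳) (h𝒵e : (∅ : Finset α) ∉ 𝒵) (m : α →₀ ℕ) :
    0 ≤ ((1 + Th1) * (PiP * gf (𝒳 ∩ 𝒵) - gf 𝒳 * gf 𝒵)
        - PiP * gf ((𝒳 ∩ 𝒵).filter fun S => #S = 1)).coeff m := by
  set Hf : MvPolynomial α ℤ := PiP * gf (𝒳 ∩ 𝒵) - gf 𝒳 * gf 𝒵 with hHf
  set Y1 : Finset (Finset α) := (𝒳 ∩ 𝒵).filter fun S => #S = 1 with hY1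
  have hH : ∀ n', 0 ≤ Hf.coeff n' := fun n' => coeff_harrisForm_nonneg_kap h𝒳 h𝒵 n'
  -- the Harris coefficient at a squarefree profile is the Kleitman surplus of the traces on that set, which is ≥ 1 through a common singleton
  have hkap : ∀ M : Finset α, Hf.coeff (ind M) = kap 𝒳 𝒵 ∅ M := fun M => by
    rw [hHf, coeff_harrisForm_eq_kap _ _ (ind_apply_le_two M), dbl_ind, sgl_ind]
  have hK1 : ∀ (M : Finset α) (j : α), j ∈ M → ({j} : Finset α) ∈ 𝒳 → ({j} : Finset α) ∈ 𝒵 → 1 ≤ Hf.coeff (ind M) := by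
    intro M j hj hjX hjZ
    rw [hkap]
    exact one_le_kap_of_loop h𝒳 h𝒵 h𝒳e h𝒵e hj (by rw [Finset.insert_empty]; exact hjX) (by rw [Finset.insert_empty]; exact hjZ)
  -- expand the coefficient
  set F1 : Finset (Finset α) := (bySize (· ≤ 1) : Finset (Finset α)).filter fun S => ind S ≤ m with hF1
  set Yf : Finset (Finset α) := Y1.filter fun T => ind T ≤ m with hYf
  have hexp : ((1 + Th1) * Hf - PiP * gf Y1).coeff m
      = Hf.coeff m + ∑ S ∈ F1, Hf.coeff (m - ind S) - ∑ T ∈ Yf, (PiP : MvPolynomial α ℤ).coeff (m - ind T) := by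
    rw [coeff_sub, add_mul, one_mul, coeff_add]
    unfold Th1
    rw [coeff_gf_mul, mul_comm (PiP : MvPolynomial α ℤ) (gf Y1), coeff_gf_mul]
  rw [hexp]
  -- keep from the Θ₁-sum only `S = ∅` and the common singletons `S ∈ Yf`
  have hsub : insert ∅ Yf ⊆ F1 := by
    intro S hS
    rw [hF1, mem_filter]
    rcases mem_insert.1 hS with rfl | hS
    · refine ⟨?_, ?_⟩
      · unfold bySize; exact mem_filter.2 ⟨mem_powerset.2 (subset_univ _), by simp⟩
      · have : ind (∅ : Finset α) = 0 := by unfold ind; rw [sum_empty]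
        rw [this]; exact bot_le
    · rw [hYf, mem_filter, hY1, mem_filter] at hS
      obtain ⟨⟨_, hcard⟩, hle⟩ := hS
      refine ⟨?_, hle⟩
      unfold bySize; exact mem_filter.2 ⟨mem_powerset.2 (subset_univ _), by omega⟩
  have hnot : (∅ : Finset α) ∉ Yf := by
    rw [hYf, mem_filter, hY1, mem_filter]; simp
  have hind0 : ind (∅ : Finset α) = 0 := by unfold ind; rw [sum_empty]
  have hF1ge : Hf.coeff m + ∑ T ∈ Yf, Hf.coeff (m - ind T) ≤ ∑ S ∈ F1, Hf.coeff (m - ind S) := by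
    have h1 : ∑ S ∈ insert ∅ Yf, Hf.coeff (m - ind S) ≤ ∑ S ∈ F1, Hf.coeff (m - ind S) :=
      sum_le_sum_of_subset_of_nonneg hsub fun S _ _ => hH _
    rw [sum_insert hnot, hind0, tsub_zero] at h1
    exact h1
  -- it suffices to bound the Yf-sum of differences from below by −(what 2·coeff m can pay)
  suffices hcore : 0 ≤ 2 * Hf.coeff m + ∑ T ∈ Yf, (Hf.coeff (m - ind T) - (PiP : MvPolynomial α ℤ).coeff (m - ind T)) by
    rw [sum_sub_distrib] at hcore
    linarith
  by_cases hA : ∀ T ∈ Yf, (PiP : MvPolynomial α ℤ).coeff (m - ind T) ≤ Hf.coeff (m - ind T)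
  · have h1 : 0 ≤ ∑ T ∈ Yf, (Hf.coeff (m - ind T) - (PiP : MvPolynomial α ℤ).coeff (m - ind T)) :=
      sum_nonneg fun T hT => sub_nonneg.2 (hA T hT)
    have h2 := hH m
    linarith
  · simp only [not_forall, not_le, exists_prop] at hA
    obtain ⟨T₀, hT₀, hlt⟩ := hA
    -- T₀ = {i₀} is a common singleton with 1_{T₀} ≤ m
    have hT₀' := hT₀
    rw [hYf, mem_filter, hY1, mem_filter, mem_inter] at hT₀'
    obtain ⟨⟨⟨hT₀X, hT₀Z⟩, hcard⟩, hle⟩ := hT₀'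
    obtain ⟨i₀, rfl⟩ := card_eq_one.1 hcard
    -- the Π-coefficient at m − e_{i₀} is 1, the Harris coefficient there is 0: m − e_{i₀} = 1_{S₀}
    have hP1 : (PiP : MvPolynomial α ℤ).coeff (m - ind {i₀}) ≤ 1 := coeff_PiP_le_one _
    have hH0 : Hf.coeff (m - ind {i₀}) = 0 := by
      have := hH (m - ind {i₀}); linarith
    have hPpos : 0 < (PiP : MvPolynomial α ℤ).coeff (m - ind {i₀}) := by linarith [hH (m - ind {i₀})]
    obtain ⟨S₀, hS₀⟩ := exists_ind_eq_of_coeff_PiP_pos hPpos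
    -- no common singleton lies in S₀
    have hnoS₀ : ∀ j ∈ S₀, ¬ (({j} : Finset α) ∈ 𝒳 ∧ ({j} : Finset α) ∈ 𝒵) := by
      intro j hj hjXZ
      have h := hK1 S₀ j hj hjXZ.1 hjXZ.2
      rw [hS₀, hH0] at h
      exact absurd h (by norm_num)
    have hi₀S₀ : i₀ ∉ S₀ := fun h => hnoS₀ i₀ h ⟨hT₀X, hT₀Z⟩
    -- m = 1_{S₀ + i₀}
    have hm : m = ind (insert i₀ S₀) := by
      have hsing : ind ({i₀} : Finset α) = Finsupp.single i₀ 1 := by unfold ind; rw [sum_singleton]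
      rw [ind_insert hi₀S₀, ← hsing, hS₀, add_comm, tsub_add_cancel_of_le hle]
    -- the Harris coefficient at m is ≥ 1
    have hm1 : 1 ≤ Hf.coeff m := by
      rw [hm]; exact hK1 _ i₀ (mem_insert_self _ _) hT₀X hT₀Z
    -- Yf = {T₀}
    have hYfeq : Yf = {{i₀}} := by
      refine eq_singleton_iff_unique_mem.2 ⟨hT₀, fun T hT => ?_⟩
      rw [hYf, mem_filter, hY1, mem_filter, mem_inter] at hT
      obtain ⟨⟨⟨hTX, hTZ⟩, hTcard⟩, hTle⟩ := hT
      obtain ⟨i, rfl⟩ := card_eq_one.1 hTcard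
      rw [hm, ind_le_ind_iff, singleton_subset_iff, mem_insert] at hTle
      rcases hTle with rfl | hi
      · rfl
      · exact absurd ⟨hTX, hTZ⟩ (hnoS₀ i hi)
    rw [hYfeq, sum_singleton]
    linarith

end Summit.CriticalPhenomena.PercolationContinuityZ3.Theorems.SahiCTCForms
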